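import Summits.ResolutionOfSingularities.ResolutionOfSingularities.Theorems.FrobeniusLadderFInjectiveMacaulayficationF4Isolated
import Mathlib.RingTheory.MvPolynomial.WeightedHomogeneous
import Mathlib.Tactic.LinearCombination
import HarnessLib

/-!
# The weighted blow-up of `f₄ = X₂² + X₀³ + X₁⁶ + X₃³X₀²` in characteristic `5`: the `X₃`-chart

Support file for crux stmt-ResolutionOfSingularities-15315
(`FrobeniusLadder.FInjectiveMacaulayfication`, registered skeleton `10f06f91`, line `Sketch`, §15 THE
WEIGHTED CONE ENGINE, calibration specimen `f₄`): registered stub `stub_f4ChartT`.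

Let `k` be a field of characteristic `5`, `S = k[X₀, X₁, X₂, X₃]`, `f₄ = X₂² + X₀³ + X₁⁶ + X₃³X₀²`
(weighted homogeneous of degree `N = 18` for the weights `w = (6, 3, 9, 2)`). The `X₃`-chart of the
weighted blow-up of the origin is governed by the root-cover substitution
`θ₃ : X₃ ↦ X₃², Xⱼ ↦ Xⱼ X₃^{wⱼ} (j ≠ 3)`, under which `θ₃ f₄ = X₃¹⁸ · g` with the chart polynomial
`g = X₂² + X₀³ + X₁⁶ + X₀²`. Unlike the `X₁`- and `X₂`-charts this chart is SINGULAR, along the whole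
`X₃`-axis `L = V(X₀, X₁, X₂)` (a line of `A₁ × 𝔸¹`-type double points: `g = X₂² + X₀²(X₀ + 1) + X₁⁶`),
so the Jacobian certificate must be complemented by Fedder's test at EVERY closed point of `L`,
rational or not. What is proved (`stub_f4ChartT`, the registered signature verbatim):

* the chart identity `θ₃ f₄ = X₃¹⁸ g` (`ring` after expanding `aeval`);
* `g` is weighted homogeneous of weight `0` for the residual weights `W = e₃ - w = (-6, -3, -9, 1)` in
  `ZMod 2` (monomial by monomial; the weights `2·(-9)`, `3·(-6)`, `6·(-3)`, `2·(-6)` vanish in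
  `ZMod 2` by `decide`);
* `X₃ ∤ g` (the evaluation at `(0, 0, 1, 0)` kills `X₃` and sends `g` to `1`);
* at EVERY maximal ideal `Q` of `S/(g)` the local ring `(S/(g))_Q` satisfies the per-stalk clause of
  the crux. Off `L` some partial `∂₂g = 2X₂`, `∂₁g = 6X₁⁵`, `∂₀g = X₀(3X₀ + 2)` misses `P = Q ∩ S`
  (Jacobian discharger `ClauseOfPderivNotMem.stub_clauseOfPderivNotMem`); if all three lie in `P` then
  `X₂, X₁ ∈ P` and `X₀ ∈ P` (else `3X₀ + 2 ∈ P` and, from `g ∈ P`, `X₀²(X₀+1) ∈ P`, so `X₀ + 1 ∈ P`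
  and `1 = 3(X₀+1) - (3X₀+2) ∈ P`), i.e. `Q` lies on `L`: `P = (X₀, X₁, X₂, c(X₃))` for a non-unit
  `c ∈ k[T]` (`FedderAlongCoordinateLine.exists_eq_span_of_X_mem`), and Fedder's test
  `g⁴ ∉ (X₀⁵, X₁⁵, X₂⁵, c(X₃)⁵)` holds UNIFORMLY in `c`: `g⁴ ≡ 6·X₀⁴X₂⁴ mod (X₀⁵, X₁⁵, X₂⁵)`
  (`g_pow_four_sub_mem`, the specialisation `X₃ := 1` of `F4Isolated.f4_pow_four_sub_mem`), `6` is a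
  unit, and `X₀⁴X₂⁴ ∉ (X₀⁵, X₁⁵, X₂⁵, c(X₃)⁵)` because the `X₀⁴X₂⁴`-extraction `E : S →+ k[T]` maps
  that ideal into `(c⁵)` and the monomial to `1` (`monomial_notMem_span_pow`); conclude by
  `FedderAtMaximalIdeal.stub_fedderAtMaximalIdeal`.

References: [Fedder1983] R. Fedder, F-purity and rational singularity, Trans. AMS 278 (1983),
Prop. 1.7 and Thm. 1.12 (through the imported test); [Matsumura1987] H. Matsumura, *Commutative Ring
Theory*, Thm. 30.4 (through the imported Jacobian discharger). The computation itself is folklore.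
-/

-- single-problem summit: the doubled namespace component is forced
set_option linter.dupNamespace false

noncomputable section

namespace Summit.ResolutionOfSingularities.ResolutionOfSingularities.Theorems.FInjectiveMacaulayfication.F4ChartT

open MvPolynomial
open Summit.ResolutionOfSingularities.ResolutionOfSingularities.Theorems.FInjectiveMacaulayfication

/-! ## The partial derivatives of the chart polynomial -/

/-- **`∂g/∂X₀ = 3X₀² + 2X₀`** for `g = X₂² + X₀³ + X₁⁶ + X₀²`, over any commutative ring. [folklore] -/
theorem pderiv_zero_g {A : Type*} [CommRing A] :
    pderiv 0 (X 2 ^ 2 + X 0 ^ 3 + X 1 ^ 6 + X 0 ^ 2 : MvPolynomial (Fin 4) A) =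
      3 * X 0 ^ 2 + 2 * X 0 := by
  simp only [map_add, pderiv_pow, pderiv_X_self,
    pderiv_X_of_ne (show (1 : Fin 4) ≠ 0 by decide), pderiv_X_of_ne (show (2 : Fin 4) ≠ 0 by decide),
    Nat.reduceSub, pow_one, mul_one, mul_zero, zero_add, add_zero, Nat.cast_ofNat]

/-- **`∂g/∂X₁ = 6X₁⁵`** for `g = X₂² + X₀³ + X₁⁶ + X₀²`, over any commutative ring. [folklore] -/
theorem pderiv_one_g {A : Type*} [CommRing A] :
    pderiv 1 (X 2 ^ 2 + X 0 ^ 3 + X 1 ^ 6 + X 0 ^ 2 : MvPolynomial (Fin 4) A) = 6 * X 1 ^ 5 := by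
  simp only [map_add, pderiv_pow, pderiv_X_self,
    pderiv_X_of_ne (show (0 : Fin 4) ≠ 1 by decide), pderiv_X_of_ne (show (2 : Fin 4) ≠ 1 by decide),
    Nat.reduceSub, pow_one, mul_one, mul_zero, add_zero, zero_add, Nat.cast_ofNat]

/-- **`∂g/∂X₂ = 2X₂`** for `g = X₂² + X₀³ + X₁⁶ + X₀²`, over any commutative ring. [folklore] -/
theorem pderiv_two_g {A : Type*} [CommRing A] :
    pderiv 2 (X 2 ^ 2 + X 0 ^ 3 + X 1 ^ 6 + X 0 ^ 2 : MvPolynomial (Fin 4) A) = 2 * X 2 := by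
  simp only [map_add, pderiv_pow, pderiv_X_self,
    pderiv_X_of_ne (show (0 : Fin 4) ≠ 2 by decide), pderiv_X_of_ne (show (1 : Fin 4) ≠ 2 by decide),
    Nat.reduceSub, pow_one, mul_one, mul_zero, add_zero, Nat.cast_ofNat]

/-! ## Weighted homogeneity of the chart polynomial -/

/-- **`g = X₂² + X₀³ + X₁⁶ + X₀²` is weighted homogeneous of weight `0`** for the residual weights
`W = (-6, -3, -9, 1)` with values in `ZMod 2` (i.e. `W = (0, 1, 1, 1)`): every monomial has even
weight. [folklore] -/
theorem isWeightedHomogeneous_g (k : Type) [Field k] :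
    MvPolynomial.IsWeightedHomogeneous (![-6, -3, -9, 1] : Fin 4 → ZMod 2)
      (X 2 ^ 2 + X 0 ^ 3 + X 1 ^ 6 + X 0 ^ 2 : MvPolynomial (Fin 4) k) 0 := by
  have hX : ∀ j : Fin 4, IsWeightedHomogeneous (![-6, -3, -9, 1] : Fin 4 → ZMod 2)
      (X j : MvPolynomial (Fin 4) k) ((![-6, -3, -9, 1] : Fin 4 → ZMod 2) j) :=
    fun j => isWeightedHomogeneous_X k _ j
  have h2 : IsWeightedHomogeneous (![-6, -3, -9, 1] : Fin 4 → ZMod 2)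
      (X 2 ^ 2 : MvPolynomial (Fin 4) k) 0 := by
    have h := (hX 2).pow 2
    rwa [show 2 • (![-6, -3, -9, 1] : Fin 4 → ZMod 2) 2 = 0 from by decide] at h
  have h03 : IsWeightedHomogeneous (![-6, -3, -9, 1] : Fin 4 → ZMod 2)
      (X 0 ^ 3 : MvPolynomial (Fin 4) k) 0 := by
    have h := (hX 0).pow 3
    rwa [show 3 • (![-6, -3, -9, 1] : Fin 4 → ZMod 2) 0 = 0 from by decide] at h
  have h16 : IsWeightedHomogeneous (![-6, -3, -9, 1] : Fin 4 → ZMod 2)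
      (X 1 ^ 6 : MvPolynomial (Fin 4) k) 0 := by
    have h := (hX 1).pow 6
    rwa [show 6 • (![-6, -3, -9, 1] : Fin 4 → ZMod 2) 1 = 0 from by decide] at h
  have h02 : IsWeightedHomogeneous (![-6, -3, -9, 1] : Fin 4 → ZMod 2)
      (X 0 ^ 2 : MvPolynomial (Fin 4) k) 0 := by
    have h := (hX 0).pow 2
    rwa [show 2 • (![-6, -3, -9, 1] : Fin 4 → ZMod 2) 0 = 0 from by decide] at h
  exact ((h2.add h03).add h16).add h02

/-! ## Fedder's test along the `X₃`-axis -/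

/-- **`g⁴ ≡ 6·x₀⁴x₂⁴` modulo every ideal containing `x₀⁵, x₁⁵, x₂⁵`**, in any commutative ring, for
`g = x₂² + x₀³ + x₁⁶ + x₀²`: the specialisation `x₃ := 1` of `F4Isolated.f4_pow_four_sub_mem` (the
only product of four summands of `g` with all exponents `< 5` is `x₂²·x₂²·x₀²·x₀²`, multinomial
coefficient `6`). [folklore] -/
theorem g_pow_four_sub_mem {A : Type*} [CommRing A] (x₀ x₁ x₂ : A) (J : Ideal A)
    (h0 : x₀ ^ 5 ∈ J) (h1 : x₁ ^ 5 ∈ J) (h2 : x₂ ^ 5 ∈ J) :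
    (x₂ ^ 2 + x₀ ^ 3 + x₁ ^ 6 + x₀ ^ 2) ^ 4 - 6 * (x₀ ^ 4 * x₂ ^ 4) ∈ J := by
  have h := F4Isolated.f4_pow_four_sub_mem x₀ x₁ x₂ 1 J h0 h1 h2
  simpa only [one_pow, one_mul, mul_one] using h

/-- **The uniform Fedder witness along the `X₃`-axis.** For a field `k` and ANY non-unit `c ∈ k[T]`,
the monomial `X₀⁴X₂⁴` does not lie in `(X₀⁵, X₁⁵, X₂⁵, c(X₃)⁵)`: the `X₀⁴X₂⁴`-extraction
`E : k[X] →+ k[T]` (`FedderAlongCoordinateLine.exists_extraction`, exponent vector `(4,0,4,0)`, line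
`ℓ = 3`) is `k[T]`-linear and kills the multiples of `X₀⁵, X₁⁵, X₂⁵`, so it maps the ideal into
`(c⁵)`, while `E (X₀⁴X₂⁴) = 1`; and `c⁵ ∣ 1` makes `c` a unit. [folklore] -/
-- adapted from `F4Isolated.monomial_notMem_span_pow` (there with an extra factor `X₃⁶` and `T ∤ c`)
theorem monomial_notMem_span_pow {k : Type} [Field k] (c : Polynomial k) (hcu : ¬IsUnit c) :
    (X 0 ^ 4 * X 2 ^ 4 : MvPolynomial (Fin 4) k) ∉
      Ideal.span (Set.range fun j : Fin 4 =>
        (if j = (3 : Fin 4) then Polynomial.aeval (X 3 : MvPolynomial (Fin 4) k) c else X j) ^ 5) := by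
  classical
  intro hmem
  obtain ⟨a, ha_def⟩ : ∃ a : Fin 4 →₀ ℕ, a = Finsupp.single 0 4 + Finsupp.single 2 4 := ⟨_, rfl⟩
  obtain ⟨E, hE⟩ := FedderAlongCoordinateLine.exists_extraction (k := k) (3 : Fin 4) a
  have ha : a 3 = 0 := by
    rw [ha_def, Finsupp.add_apply, Finsupp.single_eq_of_ne (by decide),
      Finsupp.single_eq_of_ne (by decide), add_zero]
  have hap : ∀ j : Fin 4, a j < 5 := by
    intro j
    rw [ha_def, Finsupp.add_apply, Finsupp.single_apply, Finsupp.single_apply]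
    split_ifs <;> omega
  -- `E (X₀⁴X₂⁴) = 1`
  have hmon : (X 0 ^ 4 * X 2 ^ 4 : MvPolynomial (Fin 4) k) = monomial a 1 := by
    rw [X_pow_eq_monomial, X_pow_eq_monomial, monomial_mul, one_mul, ha_def]
  have hE1 : E (X 0 ^ 4 * X 2 ^ 4) = 1 := by
    ext t
    rw [hE, hmon, coeff_monomial, Polynomial.coeff_one]
    by_cases ht : t = 0
    · rw [if_pos ht, if_pos (by rw [ht, Finsupp.single_zero, add_zero])]
    · rw [if_neg ht, if_neg]
      intro h
      have h3 := DFunLike.congr_fun h 3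
      rw [Finsupp.add_apply, ha, Finsupp.single_eq_same, zero_add] at h3
      exact ht h3.symm
  -- `E` maps the ideal into `(c⁵)`
  obtain ⟨h, hh⟩ := Ideal.mem_span_range_iff_exists_fun.mp hmem
  have hEf : E (X 0 ^ 4 * X 2 ^ 4) = E (h 3) * c ^ 5 := by
    rw [← hh, map_sum, Finset.sum_eq_single (3 : Fin 4)]
    · rw [if_pos rfl, ← map_pow, FedderAlongCoordinateLine.extraction_mul_aeval hE ha _ rfl]
    · intro j _ hj
      rw [if_neg hj, FedderAlongCoordinateLine.extraction_mul_X_pow hE hj (hap j)]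
    · intro h3
      exact absurd (Finset.mem_univ _) h3
  -- `c⁵ ∣ 1`: `c` is a unit
  have hdvd5 : c ^ 5 ∣ (1 : Polynomial k) := ⟨E (h 3), by rw [← hE1, hEf, mul_comm]⟩
  have hdvd : c ∣ (1 : Polynomial k) := (dvd_pow_self c (by norm_num : (5 : ℕ) ≠ 0)).trans hdvd5
  exact hcu (isUnit_of_dvd_one hdvd)

/-! ## Registered form -/

/-- **THE `X₃`-CHART OF THE WEIGHTED BLOW-UP OF `f₄`** (registered stub `stub_f4ChartT` of line
`Sketch`, §15 weighted cone engine, specimen `f₄ = X₂² + X₀³ + X₁⁶ + X₃³X₀²`, weights `(6,3,9,2)`,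
`N = 18`, characteristic `5`). With `g = X₂² + X₀³ + X₁⁶ + X₀²`: (i) the root-cover substitution
`θ₃ : X₃ ↦ X₃², Xⱼ ↦ XⱼX₃^{wⱼ}` gives `θ₃ f₄ = X₃¹⁸ g` (`ring`); (ii) `g` is weighted homogeneous of
weight `0` for `W = (-6, -3, -9, 1) : Fin 4 → ZMod 2` (`isWeightedHomogeneous_g`); (iii) `X₃ ∤ g`
(evaluate at `(0,0,1,0)`: `g ↦ 1`, `X₃ ↦ 0`); (iv) at every maximal ideal `Q` of `k[X]/(g)` the local
ring satisfies the per-stalk clause of the crux: if some partial `∂₀g, ∂₁g, ∂₂g` misses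
`P = Q ∩ k[X]`, by the Jacobian discharger `ClauseOfPderivNotMem.stub_clauseOfPderivNotMem`;
otherwise `X₀, X₁, X₂ ∈ P` (the singular line `V(X₀,X₁,X₂)`), `P = (X₀, X₁, X₂, c(X₃))` for a
non-unit `c` (`FedderAlongCoordinateLine.exists_eq_span_of_X_mem`), and Fedder's test
`g⁴ ∉ (X₀⁵, X₁⁵, X₂⁵, c(X₃)⁵)` holds because `g⁴ ≡ 6·X₀⁴X₂⁴ mod (X₀⁵, X₁⁵, X₂⁵)` (`g_pow_four_sub_mem`)
with `6` a unit and `X₀⁴X₂⁴ ∉ (X₀⁵, X₁⁵, X₂⁵, c(X₃)⁵)` (`monomial_notMem_span_pow`); conclude by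
`FedderAtMaximalIdeal.stub_fedderAtMaximalIdeal`. [cite: Fedder1983, Prop. 1.7 and Thm. 1.12] -/
theorem stub_f4ChartT : ∀ (k : Type) [Field k] [CharP k 5] (f g : MvPolynomial (Fin 4) k), f = MvPolynomial.X 2 ^ 2 + MvPolynomial.X 0 ^ 3 + MvPolynomial.X 1 ^ 6 + MvPolynomial.X 3 ^ 3 * MvPolynomial.X 0 ^ 2 → g = MvPolynomial.X 2 ^ 2 + MvPolynomial.X 0 ^ 3 + MvPolynomial.X 1 ^ 6 + MvPolynomial.X 0 ^ 2 → MvPolynomial.aeval (fun j : Fin 4 => if j = 3 then (MvPolynomial.X 3 : MvPolynomial (Fin 4) k) ^ 2 else MvPolynomial.X j * MvPolynomial.X 3 ^ ((![6, 3, 9, 2] : Fin 4 → ℕ) j)) f = MvPolynomial.X 3 ^ 18 * g ∧ MvPolynomial.IsWeightedHomogeneous (![-6, -3, -9, 1] : Fin 4 → ZMod 2) g 0 ∧ ¬ (MvPolynomial.X 3 : MvPolynomial (Fin 4) k) ∣ g ∧ ∀ (Q : Ideal (MvPolynomial (Fin 4) k ⧸ Ideal.span {g})) [Q.IsMaximal],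 ∀ d : ℕ, ringKrullDim (Localization.AtPrime Q) = d → ∀ s : Fin d → Localization.AtPrime Q, (Ideal.span (Set.range s)).radical.IsMaximal → RingTheory.Sequence.IsWeaklyRegular (Localization.AtPrime Q) (List.ofFn s) ∧ ∀ y : Localization.AtPrime Q, (∃ e : ℕ, y ^ 5 ^ e ∈ Ideal.span ((fun z : Localization.AtPrime Q => z ^ 5 ^ e) '' (Ideal.span (Set.range s) : Set (Localization.AtPrime Q)))) → y ∈ Ideal.span (Set.range s) := by
  intro k _ _ f g hf hg
  haveI : Fact (Nat.Prime 5) := ⟨Nat.prime_five⟩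
  -- `g ≠ 0`: `g(0,0,1,0) = 1`
  have hg1 : MvPolynomial.eval (fun j : Fin 4 => if j = 2 then (1 : k) else 0) g = 1 := by
    rw [hg]
    simp only [map_add, map_pow, MvPolynomial.eval_X, Fin.isValue, Fin.reduceEq, ↓reduceIte]
    ring
  have hg0 : g ≠ 0 := by
    intro h0
    rw [h0, map_zero] at hg1
    exact zero_ne_one hg1
  refine ⟨?_, hg ▸ isWeightedHomogeneous_g k, ?_, ?_⟩
  · -- (i) the chart identity
    subst hf hg
    simp only [map_add, map_mul, map_pow, MvPolynomial.aeval_X, Fin.isValue, Fin.reduceEq,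
      ↓reduceIte, Matrix.cons_val_zero, Matrix.cons_val_one, Matrix.cons_val]
    ring
  · -- (iii) `X₃ ∤ g`: evaluate at `(0,0,1,0)`
    rintro ⟨h, hh⟩
    have h1 := congrArg (MvPolynomial.eval fun j : Fin 4 => if j = 2 then (1 : k) else 0) hh
    rw [hg1, map_mul, MvPolynomial.eval_X] at h1
    simp only [Fin.isValue, Fin.reduceEq, ↓reduceIte, zero_mul] at h1
    exact one_ne_zero h1
  · -- (iv) the clause at every closed point
    intro Q _ d hd s hs
    haveI hP₀max : (Q.comap (Ideal.Quotient.mk (Ideal.span {g}))).IsMaximal :=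
      Ideal.comap_isMaximal_of_surjective _ Ideal.Quotient.mk_surjective
    have hP₀ := hP₀max.isPrime
    -- arithmetic of characteristic `5` in `k[X]`
    have h5 : (5 : MvPolynomial (Fin 4) k) = 0 := by
      exact_mod_cast CharP.cast_eq_zero (MvPolynomial (Fin 4) k) 5
    have hu2 : IsUnit (2 : MvPolynomial (Fin 4) k) :=
      IsUnit.of_mul_eq_one 3 (by linear_combination h5)
    have hu6 : IsUnit (6 : MvPolynomial (Fin 4) k) :=
      IsUnit.of_mul_eq_one 1 (by linear_combination h5)
    -- the partial derivatives
    have hd0 : pderiv 0 g = 3 * X 0 ^ 2 + 2 * X 0 := by rw [hg, pderiv_zero_g]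
    have hd1 : pderiv 1 g = 6 * X 1 ^ 5 := by rw [hg, pderiv_one_g]
    have hd2 : pderiv 2 g = 2 * X 2 := by rw [hg, pderiv_two_g]
    -- off the singular line: the Jacobian discharger in direction `j`
    by_cases hm2 : pderiv 2 g ∈ Q.comap (Ideal.Quotient.mk (Ideal.span {g})); swap
    · exact ClauseOfPderivNotMem.stub_clauseOfPderivNotMem 5 k 4 g Q 2 hm2 d hd s hs
    by_cases hm1 : pderiv 1 g ∈ Q.comap (Ideal.Quotient.mk (Ideal.span {g})); swap
    · exact ClauseOfPderivNotMem.stub_clauseOfPderivNotMem 5 k 4 g Q 1 hm1 d hd s hs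
    by_cases hm0 : pderiv 0 g ∈ Q.comap (Ideal.Quotient.mk (Ideal.span {g})); swap
    · exact ClauseOfPderivNotMem.stub_clauseOfPderivNotMem 5 k 4 g Q 0 hm0 d hd s hs
    -- all partials vanish at `Q`: `Q` lies on the line `X₀ = X₁ = X₂ = 0`
    have hgP : g ∈ Q.comap (Ideal.Quotient.mk (Ideal.span {g})) := by
      rw [Ideal.mem_comap, Ideal.Quotient.eq_zero_iff_mem.mpr (Ideal.mem_span_singleton_self g)]
      exact Q.zero_mem
    have hX2 : (X 2 : MvPolynomial (Fin 4) k) ∈ Q.comap (Ideal.Quotient.mk (Ideal.span {g})) := by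
      rw [hd2] at hm2
      exact (Ideal.unit_mul_mem_iff_mem _ hu2).mp hm2
    have hX1 : (X 1 : MvPolynomial (Fin 4) k) ∈ Q.comap (Ideal.Quotient.mk (Ideal.span {g})) := by
      rw [hd1] at hm1
      exact hP₀.mem_of_pow_mem 5 ((Ideal.unit_mul_mem_iff_mem _ hu6).mp hm1)
    have hX0 : (X 0 : MvPolynomial (Fin 4) k) ∈ Q.comap (Ideal.Quotient.mk (Ideal.span {g})) := by
      have e1 : (3 * X 0 ^ 2 + 2 * X 0 : MvPolynomial (Fin 4) k) = X 0 * (3 * X 0 + 2) := by ring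
      rw [hd0, e1] at hm0
      rcases hP₀.mem_or_mem hm0 with h0 | h32
      · exact h0
      · -- `3X₀ + 2 ∈ P₀`: then `X₀²(X₀ + 1) = g - X₂² - X₁⁶ ∈ P₀` forces `X₀ ∈ P₀` anyway
        have e2 : (X 0 ^ 2 * (X 0 + 1) : MvPolynomial (Fin 4) k) = g - (X 2 * X 2 + X 1 ^ 5 * X 1) := by
          rw [hg]; ring
        have hmem : (X 0 ^ 2 * (X 0 + 1) : MvPolynomial (Fin 4) k) ∈
            Q.comap (Ideal.Quotient.mk (Ideal.span {g})) := by
          rw [e2]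
          exact Ideal.sub_mem _ hgP (Ideal.add_mem _ (Ideal.mul_mem_left _ _ hX2)
            (Ideal.mul_mem_left _ _ hX1))
        rcases hP₀.mem_or_mem hmem with h02 | h01
        · exact hP₀.mem_of_pow_mem 2 h02
        · exfalso
          have e3 : (1 : MvPolynomial (Fin 4) k) = 3 * (X 0 + 1) - (3 * X 0 + 2) := by ring
          refine hP₀max.ne_top ((Ideal.eq_top_iff_one _).mpr ?_)
          rw [e3]
          exact Ideal.sub_mem _ (Ideal.mul_mem_left _ _ h01) h32
    have hXP : ∀ j : Fin 4, j ≠ 3 →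
        (X j : MvPolynomial (Fin 4) k) ∈ Q.comap (Ideal.Quotient.mk (Ideal.span {g})) := by
      intro j hj
      fin_cases j
      · exact hX0
      · exact hX1
      · exact hX2
      · exact absurd rfl hj
    -- `P₀ = (X₀, X₁, X₂, c(X₃))` for a non-unit `c ∈ k[T]`
    obtain ⟨c, hcu, hP⟩ := FedderAlongCoordinateLine.exists_eq_span_of_X_mem k 4 (3 : Fin 4)
      (Polynomial.aeval (X 3 : MvPolynomial (Fin 4) k)) rfl
      (Q.comap (Ideal.Quotient.mk (Ideal.span {g}))) hXP
    -- Fedder's test at `P₀`: `g⁴ ≡ 6·X₀⁴X₂⁴ mod (X₀⁵, X₁⁵, X₂⁵)`, `6` a unit, uniformly in `c`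
    have hfed : g ^ (5 - 1) ∉ Ideal.span (Set.range fun i : Fin 4 =>
        (if i = (3 : Fin 4) then Polynomial.aeval (X 3 : MvPolynomial (Fin 4) k) c else X i) ^ 5) := by
      intro hmem
      apply monomial_notMem_span_pow c hcu
      have hXJ : ∀ j : Fin 4, j ≠ 3 → (X j : MvPolynomial (Fin 4) k) ^ 5 ∈
          Ideal.span (Set.range fun i : Fin 4 =>
            (if i = (3 : Fin 4) then Polynomial.aeval (X 3 : MvPolynomial (Fin 4) k) c else X i) ^ 5) :=
        fun j hj => Ideal.subset_span ⟨j, by simp only [if_neg hj]⟩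
      rw [hg, show (5 - 1 : ℕ) = 4 from rfl] at hmem
      have h6 := Ideal.sub_mem _ hmem (g_pow_four_sub_mem (X 0) (X 1) (X 2) _
        (hXJ 0 (by decide)) (hXJ 1 (by decide)) (hXJ 2 (by decide)))
      rw [sub_sub_cancel] at h6
      exact (Ideal.unit_mul_mem_iff_mem _ hu6).mp h6
    exact FedderAtMaximalIdeal.stub_fedderAtMaximalIdeal 5 k 4 4
      (fun j : Fin 4 => if j = (3 : Fin 4) then Polynomial.aeval (X 3 : MvPolynomial (Fin 4) k) c
        else X j) g Q hP hg0 hfed d hd s hs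

end Summit.ResolutionOfSingularities.ResolutionOfSingularities.Theorems.FInjectiveMacaulayfication.F4ChartT

end
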